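import Literature.NumberTheory.EllipticCurves.ZpExtensionRestrict
import Literature.NumberTheory.GaloisRepresentations.AbsGaloisGroupProofs
import HarnessLib

set_option autoImplicit false

/-!
# Restriction of a `ℤ_p`-extension in stages: `(κ|_E)|_L = κ|_L` for a tower `F ⊆ E ⊆ L`

Topic `Literature/NumberTheory/EllipticCurves` (companion of `ZpExtensionRestrict.lean`).  THEOREM-ONLY file (no
definition, no named fact, no `sorry`), written by the literature seat `bsd-potss-conjA-anchor` g10 (cell
`bsd-potss`; supports stmt-BirchSwinnertonDyer-19386 / 19413) — a step of the tower identification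
`(L^H)_n = (L_n)^H` displayed in `Literature/NumberTheory/IwasawaTheory/ClassicalMuVanishesDescent.lean`: the
sub-towers there are restrictions `κ|_E` of one `ℤ_p`-extension `κ` of the base `F` to the intermediate fields
`E`, and to compare their layers inside the layers of `κ|_L` one needs `(κ|_E)|_L = κ|_L`.

The restriction maps `res_{F,E} ∘ res_{E,L}` and `res_{F,L} : Γ_L → Γ_F` are defined through DIFFERENT chosen
embeddings of algebraic closures, so they agree only up to an inner automorphism of `Γ_F` (tree theorem
`absGaloisRestrict_isConj_of_algHom_holds`, Milne FT Ch. 7); since `ℤ_p` is abelian, `κ ∘ res` is nevertheless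
the same map:

* `apply_absGaloisRestrict_absGaloisRestrict` — `κ (res_{F,E} (res_{E,L} σ)) = κ (res_{F,L} σ)`;
* `restrict_restrict` — `(κ.restrict E hE).restrict L hEL = κ.restrict L hL` (as `ℤ_p`-extensions of `L`);
* `surjective_comp_absGaloisRestrict_tower_iff` — surjectivity of `κ|_E ∘ res_{E,L}` iff of `κ ∘ res_{F,L}`.

References: [Washington1997] §13.1 (`K_∞L/L`); [MilneFT2022] Ch. 7 (restriction well defined up to conjugacy).
-/

noncomputable section

open Field Literature.NumberTheory.GaloisRepresentations

universe u v w

namespace Literature.NumberTheory.EllipticCurves.ZpExtension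

variable {F : Type u} [Field F] {p : ℕ} [Fact p.Prime]

/-- **`κ ∘ res_{F,E} ∘ res_{E,L} = κ ∘ res_{F,L}`** for a tower `F ⊆ E ⊆ L` and a `ℤ_p`-extension `κ` of `F`:
the two restriction maps `Γ_L → Γ_F` are conjugate by a fixed element of `Γ_F`
(`absGaloisRestrict_isConj_of_algHom_holds` applied to the embedding `ι_{E,L} ∘ ι_{F,E} : F̄ → L̄`, which is
compatible with `res_{F,E} ∘ res_{E,L}` by `absGaloisRestrict_apply_smul` twice), and `κ` takes values in the
abelian group `ℤ_p`. [cite: MilneFT2022, Ch. 7 (restriction defined up to conjugacy)] [cite: Washington1997, §13.1] -/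
theorem apply_absGaloisRestrict_absGaloisRestrict (κ : ZpExtension F p) (E : Type v) [Field E] [Algebra F E]
    (L : Type w) [Field L] [Algebra E L] [Algebra F L] [IsScalarTower F E L] (σ : absoluteGaloisGroup L) :
    κ (absGaloisRestrict F E (absGaloisRestrict E L σ)) = κ (absGaloisRestrict F L σ) := by
  -- the composite embedding `F̄ → Ē → L̄` and the composite restriction are compatible
  let ι' : AlgebraicClosure F →ₐ[F] AlgebraicClosure L :=
    ((absClosureEmbedding E L).restrictScalars F).comp (absClosureEmbedding F E)
  have hι' : ∀ (τ : absoluteGaloisGroup L) (x : AlgebraicClosure F),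
      ι' (absGaloisRestrict F E (absGaloisRestrict E L τ) • x) = τ • ι' x := by
    intro τ x
    change absClosureEmbedding E L (absClosureEmbedding F E (absGaloisRestrict F E (absGaloisRestrict E L τ) • x)) =
      τ • absClosureEmbedding E L (absClosureEmbedding F E x)
    rw [absGaloisRestrict_apply_smul, absGaloisRestrict_apply_smul]
  obtain ⟨τ, hτ⟩ := absGaloisRestrict_isConj_of_algHom_holds F L ι'
    (fun σ => absGaloisRestrict F E (absGaloisRestrict E L σ)) hι'
  rw [hτ σ, map_mul, map_mul, mul_right_comm, ← map_mul, mul_inv_cancel, map_one, one_mul]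

/-- **Restriction in stages: `(κ|_E)|_L = κ|_L`** — for a tower `F ⊆ E ⊆ L` of number fields and a
`ℤ_p`-extension `κ` of `F`, restricting first to `E` (tower `E·F_∞/E`) and then to `L` gives the restriction to
`L` (tower `L·F_∞/L`), whatever surjectivity witnesses are used. [cite: Washington1997, §13.1]
[cite: MilneFT2022, Ch. 7 (restriction defined up to conjugacy)] -/
theorem restrict_restrict (κ : ZpExtension F p) (E : Type v) [Field E] [NumberField E] [Algebra F E]
    (L : Type w) [Field L] [NumberField L] [Algebra E L] [Algebra F L] [IsScalarTower F E L]
    (hE : Function.Surjective (κ.toContinuousMonoidHom.comp (absGaloisRestrict F E)))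
    (hEL : Function.Surjective ((κ.restrict E hE).toContinuousMonoidHom.comp (absGaloisRestrict E L)))
    (hL : Function.Surjective (κ.toContinuousMonoidHom.comp (absGaloisRestrict F L))) :
    (κ.restrict E hE).restrict L hEL = κ.restrict L hL := by
  apply toContinuousMonoidHom_injective
  ext σ
  change (κ.restrict E hE).restrict L hEL σ = κ.restrict L hL σ
  rw [restrict_apply, restrict_apply, restrict_apply]
  exact apply_absGaloisRestrict_absGaloisRestrict κ E L σ

/-- Surjectivity transfers along the tower: `κ|_E ∘ res_{E,L}` is surjective iff `κ ∘ res_{F,L}` is (same map).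
[cite: Washington1997, §13.1] -/
theorem surjective_comp_absGaloisRestrict_tower_iff (κ : ZpExtension F p) (E : Type v) [Field E]
    [NumberField E] [Algebra F E] (L : Type w) [Field L] [NumberField L] [Algebra E L] [Algebra F L]
    [IsScalarTower F E L]
    (hE : Function.Surjective (κ.toContinuousMonoidHom.comp (absGaloisRestrict F E))) :
    Function.Surjective ((κ.restrict E hE).toContinuousMonoidHom.comp (absGaloisRestrict E L)) ↔
      Function.Surjective (κ.toContinuousMonoidHom.comp (absGaloisRestrict F L)) := by
  have key : ∀ σ, ((κ.restrict E hE).toContinuousMonoidHom.comp (absGaloisRestrict E L)) σ =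
      (κ.toContinuousMonoidHom.comp (absGaloisRestrict F L)) σ := fun σ => by
    change (κ.restrict E hE) (absGaloisRestrict E L σ) = κ (absGaloisRestrict F L σ)
    rw [restrict_apply]
    exact apply_absGaloisRestrict_absGaloisRestrict κ E L σ
  have heq : ((κ.restrict E hE).toContinuousMonoidHom.comp (absGaloisRestrict E L) : absoluteGaloisGroup L → _) =
      (κ.toContinuousMonoidHom.comp (absGaloisRestrict F L)) := funext key
  rw [heq]

end Literature.NumberTheory.EllipticCurves.ZpExtension

end
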